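import Mathlib
import Summits.Ventures.HodgeRepro.Tier4.Line4.ArchMatchingSeesaw
import Summits.Ventures.HodgeRepro.Tier4.Line1.LocallyCompactGA
import Summits.Ventures.HodgeRepro.Tier4.Line1.SecondCountableGA

/-!
# Tier4/Line4/ArchFourierOpen — C-L4-HF-TORUS, part 3: the `hF` integral is CONTINUOUS in `γ`, so the archimedean
conjunct `hF(γ) ≠ 0` of the `γ₀`-existence display is an OPEN condition on `γ ∈ G(𝔸)`

Blind re-derivation cell `pub-hodge-repro`, Tier 4 «prove the step» (README §9–§10), seat t4-L4-x2 (extra prover, LINE L4,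
gen 2; self-named cut S16292 / S16345 (ii)).  Target tree path `lean/Summits/Ventures/HodgeRepro/Tier4/Line4/ArchFourierOpen.lean`.
Beside part 2 (Tier4/Line4/ArchFourierTorus p719042; not imported — the integrand is part 2's verbatim), on L1-p5's
ArchMatchingSeesaw (p709235: `archWitnessOf`) and ArchProdCoeff (`continuous_archWitness(')`), LocallyCompactGA
(p664342: `locallyCompact_GA`), SecondCountableGA (p664234: `secondCountable_GA`) and Mathlib's
`continuous_parametric_integral_of_continuous` (a jointly continuous integrand over a compact set of a locally finite
measure); no printed input.

WHAT IS PROVED.  `continuous_archWitnessOf` (the branch witness is continuous under the `U(1,1)` signs at `w₀`);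
**`continuous_integral_chi_archWitnessOf`**: with `T_∞` compact, `νinf` finite and `χ` continuous,
`γ ↦ ∫_{T_∞} χ(t) · archWitnessOf (t⁻¹ γ) ∂νinf` is continuous on `G(𝔸)`; **`isOpen_setOf_integral_chi_archWitnessOf_ne_zero`**:
`{γ | ∫_{T_∞} χ(t) · archWitnessOf (t⁻¹ γ) ≠ 0}` is OPEN.  READING: once the archimedean conjunct holds at ONE point of
`G(𝔸)` it holds on a neighbourhood, so it never obstructs a rational `γ₀` by itself — the obstruction, if any, is the joint
choice with the finite-place conjuncts (the display's `p`-integrality and `J_v(γ₀) ≠ 0`), which this module does not touch.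
Nothing here says anything about the status of the Hodge conjecture for CM abelian varieties, which is NOT proved (HC_CM is
NOT proved by anyone in this repository).
-/

set_option autoImplicit false

noncomputable section

namespace Summit.Ventures.HodgeRepro.Tier4.Line4

open Summit.Ventures.HodgeRepro.Tier4.Common Summit.Ventures.HodgeRepro.Tier4.Line1 NumberField Matrix MeasureTheory

open scoped Classical

section Continuity

variable {k : Type} [Field k] [NumberField k] (q : QuadData k) (a : Fin 4 → k)
  (g g' : Matrix (Fin 4) (Fin 4) k) (hgg' : g * g' = 1) (hg'g : g' * g = 1)
  (hgΩ : g * (PlaneData.mixedRow q (a 0) (a 2)).Ω = (PlaneData.mixedRow q (a 0) (a 2)).Ω * g)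
  (lam : k)
  (hiso : g * (PlaneData.mixedRow q (a 1) (a 3)).B * gᵀ = lam • (PlaneData.mixedRow q (a 0) (a 2)).B)
  (w₀ : InfinitePlace k) (eP' eM' : InfinitePlace k → ℤ)

/-- **the branch witness is continuous** (`U(1,1)` signs at `w₀`; `continuous_archWitness(')` through the branch split). -/
theorem continuous_archWitnessOf (hw₀ : w₀.IsReal) (hcm₀ : IsCMAt q w₀)
    (ha1 : 0 < (adToC w₀ (algebraMap k (Ad k) (a 1))).re) (ha3 : (adToC w₀ (algebraMap k (Ad k) (-1 * a 3))).re < 0) :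
    Continuous (archWitnessOf q a g g' hgg' hg'g hgΩ lam hiso w₀ eP' eM') := by
  unfold archWitnessOf
  split_ifs
  · exact continuous_archWitness q a g g' hgg' hg'g hgΩ lam hiso w₀ eP' eM' hw₀ hcm₀ ha1 ha3
  · exact continuous_archWitness' q a g g' hgg' hg'g hgΩ lam hiso w₀ eP' eM' hw₀ hcm₀ ha1 ha3

variable [MeasurableSpace (GA ((PlaneData.mixedRow q (a 0) (a 2)).withTransportedTorus g g' hgg' hg'g hgΩ))]
  [BorelSpace (GA ((PlaneData.mixedRow q (a 0) (a 2)).withTransportedTorus g g' hgg' hg'g hgΩ))]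
  (R : RTFData ((PlaneData.mixedRow q (a 0) (a 2)).withTransportedTorus g g' hgg' hg'g hgΩ))
  (νinf : Measure (torusInf ((PlaneData.mixedRow q (a 0) (a 2)).withTransportedTorus g g' hgg' hg'g hgΩ)))

/-- **THE `hF` INTEGRAL IS CONTINUOUS IN `γ`**: with `T_∞` compact, `νinf` finite and `χ` continuous, the parametric
integral `γ ↦ ∫_{T_∞} χ(t) · archWitnessOf (t⁻¹ γ) ∂νinf` is continuous on the locally compact, second countable `G(𝔸)`
(`continuous_parametric_integral_of_continuous` on the compact set `univ`). -/
theorem continuous_integral_chi_archWitnessOf [CompactSpace (torusInf ((PlaneData.mixedRow q (a 0) (a 2)).withTransportedTorus g g' hgg' hg'g hgΩ))] [IsFiniteMeasure νinf]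
    (hc : Continuous R.chi) (hw₀ : w₀.IsReal) (hcm₀ : IsCMAt q w₀)
    (ha1 : 0 < (adToC w₀ (algebraMap k (Ad k) (a 1))).re) (ha3 : (adToC w₀ (algebraMap k (Ad k) (-1 * a 3))).re < 0) :
    Continuous fun γ : GA ((PlaneData.mixedRow q (a 0) (a 2)).withTransportedTorus g g' hgg' hg'g hgΩ) => (∫ t : torusInf ((PlaneData.mixedRow q (a 0) (a 2)).withTransportedTorus g g' hgg' hg'g hgΩ),
        R.chi t * archWitnessOf q a g g' hgg' hg'g hgΩ lam hiso w₀ eP' eM' ((((t : torusT ((PlaneData.mixedRow q (a 0) (a 2)).withTransportedTorus g g' hgg' hg'g hgΩ)) : GA ((PlaneData.mixedRow q (a 0) (a 2)).withTransportedTorus g g' hgg' hg'g hgΩ)))⁻¹ * γ) ∂νinf) := by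
  haveI := locallyCompact_GA ((PlaneData.mixedRow q (a 0) (a 2)).withTransportedTorus g g' hgg' hg'g hgΩ)
  haveI : SecondCountableTopology (GA ((PlaneData.mixedRow q (a 0) (a 2)).withTransportedTorus g g' hgg' hg'g hgΩ)) := secondCountable_GA ((PlaneData.mixedRow q (a 0) (a 2)).withTransportedTorus g g' hgg' hg'g hgΩ)
  have hF := continuous_archWitnessOf q a g g' hgg' hg'g hgΩ lam hiso w₀ eP' eM' hw₀ hcm₀ ha1 ha3
  have hcoe : Continuous fun t : torusInf ((PlaneData.mixedRow q (a 0) (a 2)).withTransportedTorus g g' hgg' hg'g hgΩ) => ((t : torusT ((PlaneData.mixedRow q (a 0) (a 2)).withTransportedTorus g g' hgg' hg'g hgΩ)) : GA ((PlaneData.mixedRow q (a 0) (a 2)).withTransportedTorus g g' hgg' hg'g hgΩ)) :=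
    continuous_subtype_val.comp continuous_subtype_val
  have hf : Continuous (Function.uncurry fun (γ : GA ((PlaneData.mixedRow q (a 0) (a 2)).withTransportedTorus g g' hgg' hg'g hgΩ))
      (t : torusInf ((PlaneData.mixedRow q (a 0) (a 2)).withTransportedTorus g g' hgg' hg'g hgΩ)) => R.chi t * archWitnessOf q a g g' hgg' hg'g hgΩ lam hiso w₀ eP' eM' ((((t : torusT ((PlaneData.mixedRow q (a 0) (a 2)).withTransportedTorus g g' hgg' hg'g hgΩ)) : GA ((PlaneData.mixedRow q (a 0) (a 2)).withTransportedTorus g g' hgg' hg'g hgΩ)))⁻¹ * γ)) := by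
    refine Continuous.mul ((hc.comp continuous_subtype_val).comp continuous_snd) (hF.comp ?_)
    exact ((hcoe.comp continuous_snd).inv).mul continuous_fst
  have h := continuous_parametric_integral_of_continuous (μ := νinf) hf (isCompact_univ (X := torusInf ((PlaneData.mixedRow q (a 0) (a 2)).withTransportedTorus g g' hgg' hg'g hgΩ)))
  simpa only [Measure.restrict_univ] using h

/-- **the archimedean conjunct is an OPEN condition**: `{γ | ∫_{T_∞} χ(t) · archWitnessOf (t⁻¹ γ) ∂νinf ≠ 0}` is open in `G(𝔸)`. -/
theorem isOpen_setOf_integral_chi_archWitnessOf_ne_zero [CompactSpace (torusInf ((PlaneData.mixedRow q (a 0) (a 2)).withTransportedTorus g g' hgg' hg'g hgΩ))] [IsFiniteMeasure νinf]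
    (hc : Continuous R.chi) (hw₀ : w₀.IsReal) (hcm₀ : IsCMAt q w₀)
    (ha1 : 0 < (adToC w₀ (algebraMap k (Ad k) (a 1))).re) (ha3 : (adToC w₀ (algebraMap k (Ad k) (-1 * a 3))).re < 0) :
    IsOpen {γ : GA ((PlaneData.mixedRow q (a 0) (a 2)).withTransportedTorus g g' hgg' hg'g hgΩ) | (∫ t : torusInf ((PlaneData.mixedRow q (a 0) (a 2)).withTransportedTorus g g' hgg' hg'g hgΩ),
        R.chi t * archWitnessOf q a g g' hgg' hg'g hgΩ lam hiso w₀ eP' eM' ((((t : torusT ((PlaneData.mixedRow q (a 0) (a 2)).withTransportedTorus g g' hgg' hg'g hgΩ)) : GA ((PlaneData.mixedRow q (a 0) (a 2)).withTransportedTorus g g' hgg' hg'g hgΩ)))⁻¹ * γ) ∂νinf) ≠ 0} :=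
  isOpen_ne_fun (continuous_integral_chi_archWitnessOf q a g g' hgg' hg'g hgΩ lam hiso w₀ eP' eM' R νinf hc hw₀ hcm₀
    ha1 ha3) continuous_const

end Continuity

end Summit.Ventures.HodgeRepro.Tier4.Line4
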